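import Literature.MathematicalPhysics.QuantumFieldTheory.Balaban1983to89.B6Eq2129TwoScaleV1
import Literature.MathematicalPhysics.QuantumFieldTheory.Balaban1983to89.B6Eq2118DeltaJInverse
import Literature.MathematicalPhysics.QuantumFieldTheory.Balaban1983to89.B6SectAWholeTorusData

/-!
# `Balaban1983to89.B6Eq2130TwoScaleV1Landau` — T. Bałaban, *Propagators and renormalization transformations for lattice gauge
# theories. II*, Commun. Math. Phys. **96** (1984) 223–250 [Balaban1984PropagatorsII], p. 246 after (2.130): ***"Thus this operator
# coincides with the operator introduced in Sect. D"*** [of [4] = T. Bałaban, *… I*, Commun. Math. Phys. **95** (1984) 17–40,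
# Balaban1984PropagatorsI] and p. 243 (2.118) ***"the quadratic forms are equal to ⟨B, Δ_jB⟩ given by (1.66)"*** — CONCRETELY, for the
# two-scale V1 operators `tsV1`: the derived `G_j`, `(Q_jG_jQ_j*)⁻¹`, `H_j` (2.130), `Δ_j` (2.118) of the representation (2.129) ARE
# p21's Sect. A operators at the whole-torus family of order `j` and, through p16's bridge, [BIJ85] (4.4.2)/[B5] (1.63)/(1.103) `H_j`
# and the [B5] (1.19)/(1.65) form `Δ_j`

statement-level skeleton of published theorems with citation tags; proofs where landed; nothing here is a claim about the Yang–Mills mass gap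

PDF held: `paper:balaban1984-cmp96-propagators-rt-ii` (journal page = PDF page + 222; pp. 243, 246 [PDF 21, 24] read from the materialised
text `~/.lit/texts/paper-balaban1984-cmp96-propagators-rt-ii/p0021.txt`, `p0024.txt`, this seat, 2026-08-21); `paper:balaban1984-cmp95-
propagators-rt-i` (journal page = PDF page + 16; pp. 29, 34 [PDF 13, 18], text layer, this seat).

PRINT (verbatim, text layer).  [B6] p. 243: *"The operator H_j may be different from the operator defined in Sect. D of [4], because
there is the exponential gauge fixing term instead of the δ-function, but we will prove later that they are equal. … Thus both factors
are equal and in fact the quadratic forms are equal to ⟨B, Δ_jB⟩ given by (1.66) and satisfying (1.67): γ₀‖∂₁B‖² ≦ ⟨B, Δ_jB⟩ ≦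
γ₁‖∂₁B‖². (2.118)"*; p. 246: *"We have to investigate yet the operators G̃_j, H_j and H′_j. Doing similar calculations as in Sect. E,
(1.91)–(1.103), in fact much simpler, we get the formula H_j = G_jQ_j*(Q_jG_jQ_j*)⁻¹ (2.130) Thus this operator coincides with the
operator introduced in Sect. D. … From these representations we obtain all the necessary properties of the operators H_j, G̃_j. They
follow from the Proposition 1.2 and from the formulas and the inequalities (1.99)–(1.101) for Q_jG_jQ_j*."*  [B5] p. 29: *"Using (1.60),
or better (1.63), we can verify all the properties of H_kB: Q_kH_kB = B, R∂*H_kB = 0, H_kB is a minimum of ½⟨∂A, ∂A⟩ on the hyperplane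
{A : Q_kA = B, R∂*A = 0} … The action Δ_k is thus defined by ⟨B, Δ_kB⟩ = ⟨∂H_kB, ∂H_kB⟩. (1.65)"*; p. 34: *"so finally we get the
representation H_kB = GQ*(QGQ*)⁻¹B. (1.103)"*.

CITATION HEADER (lean-in-tree rule) — WHAT IS REPRODUCED.  Phase-2 file of the `lit-balaban` typed skeleton (HOME
`run/shared/lean/pub/lit-balaban/`), seat **p22 gen 9** (B6 fold owner r03, referee ref-4).  KNITTING of SKELETON rows **B6.Eq2.130** /
**B6.Eq2.118** (decls of record: `…B6SectCOperators.TwoScaleData.Hj`/`.Gj`/`.Ej`/`.Δj` p255063 and their concrete data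
`…B6SectCTwoScaleV1Lattice.tsV1` p257090 — untouched) with **B6.Eq2.35** at the whole torus / **B5.Eq1.63** / **B5.Eq1.103** /
**C1.Eq4.4.1-4.4.3** (p16's `…B6SectAWholeTorusBridge.hOp_whole_eq_Hk` p262845, `…B6SectAWholeTorusData.hOp_whole_rdE_symm`/`rdE` p263768,
p21's `…B6SectAVectorModelV1.GE`/`EE`/`qgqE`, p11's `BIJ85LandauMinimizer442.Hk` on `opsV1 P j c s` — untouched) and **B5.Eq1.65** (p16's
`…B5Eq165GaugeMinimaV1.inner_DeltaK_eq_norm_curl_Hk_sq`, the (1.19) matrix `…B5Eq119GaussianV1.DeltaK` — untouched), for the CONCRETE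
two-scale data `D = tsV1 hc Λ′ w` of this seat's gen 8 (fine torus `T^{(0)}` with factor `c ≠ 0`, unit lattice `T^{(j)}`, `j + 1 ≤ m + K`,
`Λ′ ⊂ T^{(j+1)}`, weights `w > 0`):
* §1 the one-level pieces of `tsV1` ARE p21's whole-torus operators of order `j`: `Q_j = rdE ∘ Q` (`Qv_eq_rdE_QE`), `Q_j* = Q* ∘ rdE⁻¹`
  (`adjoint_Qv_eq`), `N(Q′_j) = N(Q′)` (`ker_Qp_eq`), **`R_j = R`** of (2.10)/(2.97) (`Rj_eq_RE`);
* §2 **`Δ − ∂P_j∂* + Q_j*Q_j = Δ_a` (weight 1) and `G_j = G = Δ_a⁻¹` of the whole-torus family of order `j`** (`MjQ_eq_deltaAE`,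
  `Gj_eq_GE`), `Q_jG_jQ_j* = rdE ∘ QGQ* ∘ rdE⁻¹` (`QGQ_apply`), **`(Q_jG_jQ_j*)⁻¹ = rdE ∘ (QGQ*)⁻¹ ∘ rdE⁻¹`** (`Ej_apply`);
* §3 **(2.130) = (2.35) = (4.4.2)/(1.63)/(1.103): `H_jB = GQ*(QGQ*)⁻¹(rdE⁻¹B) = H_k(opsV1 P j c s) B`** for EVERY `B` and every
  norm weight `s ≠ 0` (`Hj_apply_V1`, **`Hj_eq_Hk`**, `Hj_eq_Hk'`), the tower closed form (1.63) (`tVE_Hj`), and the Landau gauge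
  condition of [B5] p. 29 for the concrete `H_j` (`RE_dsE_Hj_eq_zero`, `projR_dstar_Hj_eq_zero`, `Hj_mem_lan`);
* §4 **(2.118) «given by (1.66)»: `⟨B, Δ_jB⟩ = ‖∂H_jB‖² = ⟨B, Δ_j^{[4]}B⟩`** with `Δ_j^{[4]}` the (1.19)/(1.65) matrix `DeltaK P j 1 c`
  (`inner_Δj_V1`, **`inner_Δj_eq_DeltaK`**), and `⟨B, (Q_jG_jQ_j*)⁻¹B⟩ = ‖B‖² + ⟨B, Δ_j^{[4]}B⟩` (`inner_Ej_eq_DeltaK`).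
* §5 (v1.1) **the KERNEL of the concrete `H_j` IS the (1.63) torus kernel of [B5]** (r02-lineage `…B5Hk163Torus.HkOp`, whose
  exponential decay `norm_HkOp_le` is row B5.Claim@28): `(H_jB)(b₀) = Re((HkOp (L^j) (Mk P j)·B̃)(b̃₀))` (`Hj_apply_eq_HkOp`), the matrix
  entry `H_j(b₀, b) = Re HkOp(b̃₀, b̃)` (`Hj_single_apply`, `Hj_single_apply'`) and `|H_j(b₀, b)| ≤ ‖HkOp(b̃₀, b̃)‖` (`abs_Hj_single_le_norm_HkOp`) — p. 246
  *"From these representations we obtain all the necessary properties of the operators H_j …"* for the kernel of `H_j`, BY NAME.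
THEOREMS ONLY (no definition, no `def … : Prop`, nothing is a named unproved fact; standard axioms).  HONEST SCOPE: the finite-dimensional
`ℓ²` model of gen 8 (`G_j` with weight `1`; `H_j`, `(Q_jG_jQ_j*)⁻¹H_j`-independent facts only); (1.65) ↔ the momentum form (1.66) and the
(1.67)/(2.118) constants are rows B5.Eq1.66/B5.Eq1.67 (other files, other carriers) and are NOT claimed; NOT summit progress.
-/

noncomputable section

open scoped InnerProductSpace Matrix

namespace Literature.MathematicalPhysics.QuantumFieldTheory.Balaban1983to89.B6Eq2130TwoScaleV1Landau

open B6SectADomainsV1 B6SectAOperatorsV1 B6SectAVectorModelV1 B6SectCOperators B6SectCOperators.TwoScaleData B6SectCTwoScaleV1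
  B6SectCTwoScaleV1Lattice B6SectAWholeTorusBridge B6SectAWholeTorusData B6CovarianceOperator LatticeFieldCalculus
open BalabanImbrieJaffe1984to88.BIJ85AxialPropagator411 (BondSpace)
open BalabanImbrieJaffe1984to88.BIJ85LandauMinimizer442 (Hk)
open BalabanImbrieJaffe1984to88.BIJ85LandauMinimizer442V1 (opsV1 opsV1_Qk)

variable {P : Params} {c : ℝ} (hc : c ≠ 0) {j : ℕ} (hj : j + 1 ≤ P.m + P.K) (Λ' : Finset (Site P (j + 1)))
  {w : CIdx j Λ' → ℝ} (hw : ∀ i, 0 < w i) {s : ℝ}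

/-! ## §1  `Q_j`, `Q_j*`, `N(Q′_j)`, `R_j` of `tsV1` are the whole-torus Sect. A operators of order `j` -/

/-- `Q_j` of `tsV1` is p21's multi-scale datum `Q` (2.20) at the whole-torus family of order `j`, reindexed by p16's `rdE`:
`Q_jA = rdE(QA)`. [cite: Balaban1984PropagatorsII, (2.20) p.226 + (2.95) p.240] -/
theorem Qv_eq_rdE_QE (hj' : j ≤ P.m + P.K) (x : BondSpace P) :
    Qv P j x = rdE hj' (QE (Domains.whole (P := P) j hj') x) := by
  apply PiLp.ext
  intro b
  rw [Qv_apply, rdE_apply, QE_whole_apply]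
  rfl

/-- `Q_j*` of `tsV1` is `Q* ∘ rdE⁻¹` (p21's `QsE` = the adjoint of `Q`). [cite: Balaban1984PropagatorsII, (2.19)–(2.20) p.226] -/
theorem adjoint_Qv_eq (hj' : j ≤ P.m + P.K) (y : UBond P j) :
    LinearMap.adjoint (Qv P j) y = QsE (Domains.whole (P := P) j hj') ((rdE hj').symm y) := by
  apply ext_inner_right ℝ
  intro x
  rw [LinearMap.adjoint_inner_left, inner_QsE_left, Qv_eq_rdE_QE hj' x,
    ← (rdE hj').inner_map_map ((rdE hj').symm y) (QE (Domains.whole (P := P) j hj') x), LinearIsometryEquiv.apply_symm_apply]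

/-- **`N(Q′_j) = ker Q′_j` of `tsV1` IS `N(Q′)` (2.7)/(2.10) of the whole-torus family of order `j`.** [cite: Balaban1984PropagatorsII, (2.10) p.225 + (2.95) p.240] -/
theorem ker_Qp_eq (hj' : j ≤ P.m + P.K) :
    LinearMap.ker (Qp P j) = LinearMap.ker (QpE (Domains.whole (P := P) j hj')) := by
  ext f
  rw [LinearMap.mem_ker, mem_ker_QpE_whole_iff]
  constructor
  · intro h
    have h' := congrArg WithLp.ofLp h
    rw [ofLp_Qp, WithLp.ofLp_zero] at h'
    exact h'
  · intro h
    apply PiLp.ext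
    intro y
    show siteAvgIter j (WithLp.ofLp f) y = (0 : USite P j) y
    rw [h]
    rfl

/-- **`R_j` of (2.97) for `tsV1` IS `R` (2.10)/(2.17) of the whole-torus family of order `j`** (the orthogonal projection onto
`ΔN(Q′_j)`; by p16's `RE_whole_eq` also p11's `projR` of [B5] (1.47)). [cite: Balaban1984PropagatorsII, (2.10) p.225 + (2.97) p.240] -/
theorem Rj_eq_RE (hj' : j ≤ P.m + P.K) : (tsV1 hc Λ' w).Rj = RE (Domains.whole (P := P) j hj') c := by
  have key : ∀ {K K' : Submodule ℝ (ScalarSpace P)} (_ : K = K') [K.HasOrthogonalProjection] [K'.HasOrthogonalProjection],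
      (K.starProjection : ScalarSpace P →L[ℝ] ScalarSpace P) = K'.starProjection := by
    intro K K' h _ _
    subst h
    rfl
  show (((LinearMap.ker (Qp P j)).map (lapE c)).starProjection : ScalarSpace P →L[ℝ] ScalarSpace P).toLinearMap =
    (((LinearMap.ker (QpE (Domains.whole (P := P) j hj'))).map (lapE c)).starProjection :
      ScalarSpace P →L[ℝ] ScalarSpace P).toLinearMap
  rw [key (congrArg (Submodule.map (lapE c)) (ker_Qp_eq (P := P) hj'))]

/-! ## §2  `G_j = (Δ − ∂P_j∂* + Q_j*Q_j)⁻¹` IS `G = Δ_a⁻¹` of the whole torus of order `j`; `(Q_jG_jQ_j*)⁻¹` -/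

include hj hw

omit hw in
/-- the norm weight `‖Q_jA‖²` on `T^{(j)}` is the `𝔅`-sum of the whole-torus family with unit weights. [cite: Balaban1984PropagatorsII, (2.19) p.226] -/
theorem norm_Qv_sq_eq_sum (v : BondSpace P) :
    ‖(tsV1 hc Λ' w).Qv v‖ ^ 2 = ∑ i, (1 : ℝ) * QE (Domains.whole (P := P) j (Nat.le_of_succ_le hj)) v i ^ 2 := by
  rw [← real_inner_self_eq_norm_sq, inner_eq_sum, ← (idxB_bijective (Nat.le_of_succ_le hj)).sum_comp]
  refine Finset.sum_congr rfl fun b _ => ?_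
  rw [one_mul, QE_whole_apply, sq]
  rfl

/-- **`Δ − ∂P_j∂* + Q_j*Q_j` of `tsV1` IS `Δ_a = ∂*∂ + ∂R∂* + Q*Q` (2.19) of the whole-torus family of order `j` with unit weights** —
[B5] (1.69) *"Δ_a = Δ − ∂P∂* + aQ*Q … R = I − P"* at `a = 1`. [cite: Balaban1984PropagatorsII, (2.19) p.226 + (2.130) p.246] -/
theorem MjQ_eq_deltaAE :
    (tsV1 hc Λ' w).Mj + LinearMap.adjoint (tsV1 hc Λ' w).Qv ∘ₗ (tsV1 hc Λ' w).Qv =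
      deltaAE (Domains.whole (P := P) j (Nat.le_of_succ_le hj)) c (fun _ => 1) := by
  have hL := isLattice Λ' hc hj hw
  set Wj := Domains.whole (P := P) j (Nat.le_of_succ_le hj) with hWj
  set S := ((tsV1 hc Λ' w).Mj + LinearMap.adjoint (tsV1 hc Λ' w).Qv ∘ₗ (tsV1 hc Λ' w).Qv) - deltaAE Wj c (fun _ => 1) with hS
  have hsym : S.IsSymmetric := fun x y => by
    rw [hS, LinearMap.sub_apply, LinearMap.sub_apply, inner_sub_left, inner_sub_right, B6SectCPositivity.MjQ_symm hL,
      inner_deltaAE_left]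
  have h1 : ∀ v : BondSpace P, ⟪v, ((tsV1 hc Λ' w).Mj + LinearMap.adjoint (tsV1 hc Λ' w).Qv ∘ₗ (tsV1 hc Λ' w).Qv) v⟫_ℝ =
      ‖dcE c v‖ ^ 2 + ‖RE Wj c (dsE c v)‖ ^ 2 + ∑ i, (1 : ℝ) * QE Wj v i ^ 2 := by
    intro v
    rw [LinearMap.add_apply, inner_add_right, form_Mj hL, LinearMap.comp_apply, LinearMap.adjoint_inner_right,
      real_inner_self_eq_norm_sq, norm_Qv_sq_eq_sum hc hj Λ', Rj_eq_RE hc Λ' (Nat.le_of_succ_le hj)]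
    rfl
  have h0 : ∀ v, ⟪S v, v⟫_ℝ = 0 := fun v => by
    rw [hS, LinearMap.sub_apply, inner_sub_left, B6SectCPositivity.MjQ_symm hL, inner_deltaAE_left, h1, inner_deltaAE_self]
    exact sub_self _
  exact sub_eq_zero.mp (hsym.inner_map_self_eq_zero.mp h0)

/-- **`G_j` of (2.129)/(2.130) for `tsV1` IS `G = Δ_a⁻¹` (2.22) of the whole-torus family of order `j`** (weight `1`) — the
one-level propagator `G_k` of [B5] (1.71). [cite: Balaban1984PropagatorsII, (2.130) p.246] -/
theorem Gj_eq_GE :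
    (tsV1 hc Λ' w).Gj = GE (Domains.whole (P := P) j (Nat.le_of_succ_le hj)) hc (w := fun _ => (1 : ℝ)) (fun _ => one_pos) := by
  have hL := isLattice Λ' hc hj hw
  have hP := positive Λ' hc hj w
  refine LinearMap.ext fun v => ?_
  have h2 : ((tsV1 hc Λ' w).Mj + LinearMap.adjoint (tsV1 hc Λ' w).Qv ∘ₗ (tsV1 hc Λ' w).Qv)
      (GE (Domains.whole (P := P) j (Nat.le_of_succ_le hj)) hc (w := fun _ => (1 : ℝ)) (fun _ => one_pos) v) = v := by
    rw [MjQ_eq_deltaAE hc hj Λ' hw]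
    exact deltaAE_GE _ hc _ v
  calc (tsV1 hc Λ' w).Gj v
      = (tsV1 hc Λ' w).Gj (((tsV1 hc Λ' w).Mj + LinearMap.adjoint (tsV1 hc Λ' w).Qv ∘ₗ (tsV1 hc Λ' w).Qv)
          (GE (Domains.whole (P := P) j (Nat.le_of_succ_le hj)) hc (w := fun _ => (1 : ℝ)) (fun _ => one_pos) v)) := by rw [h2]
    _ = GE (Domains.whole (P := P) j (Nat.le_of_succ_le hj)) hc (w := fun _ => (1 : ℝ)) (fun _ => one_pos) v :=
        inverse_apply _ (B6SectCPositivity.MjQ_pos hL hP) _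

/-- **`Q_jG_jQ_j*` of `tsV1` IS `QGQ*` (p. 228 / [B5] (1.99)) of the whole-torus family of order `j`, conjugated by `rdE`.**
[cite: Balaban1984PropagatorsII, p.228 + (2.130) p.246] -/
theorem QGQ_apply (y : UBond P j) :
    (tsV1 hc Λ' w).Qv ((tsV1 hc Λ' w).Gj (LinearMap.adjoint (tsV1 hc Λ' w).Qv y)) =
      rdE (Nat.le_of_succ_le hj) (qgqE (Domains.whole (P := P) j (Nat.le_of_succ_le hj)) hc (w := fun _ => (1 : ℝ))
        (fun _ => one_pos) ((rdE (Nat.le_of_succ_le hj)).symm y)) := by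
  show Qv P j ((tsV1 hc Λ' w).Gj (LinearMap.adjoint (Qv P j) y)) = _
  rw [Gj_eq_GE hc hj Λ' hw, adjoint_Qv_eq (Nat.le_of_succ_le hj), Qv_eq_rdE_QE (Nat.le_of_succ_le hj), qgqE_def]
  rfl

/-- **`(Q_jG_jQ_j*)⁻¹` of (2.130) for `tsV1` IS `(QGQ*)⁻¹` (p. 228 *"an inverse is a well-defined and positive operator"*) of the
whole-torus family of order `j`, conjugated by `rdE`.** [cite: Balaban1984PropagatorsII, (2.35) p.228 + (2.130) p.246] -/
theorem Ej_apply (y : UBond P j) :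
    (tsV1 hc Λ' w).Ej y =
      rdE (Nat.le_of_succ_le hj) (EE (Domains.whole (P := P) j (Nat.le_of_succ_le hj)) hc (w := fun _ => (1 : ℝ))
        (fun _ => one_pos) ((rdE (Nat.le_of_succ_le hj)).symm y)) := by
  have hL := isLattice Λ' hc hj hw
  have hP := positive Λ' hc hj w
  set z := rdE (Nat.le_of_succ_le hj) (EE (Domains.whole (P := P) j (Nat.le_of_succ_le hj)) hc (w := fun _ => (1 : ℝ))
    (fun _ => one_pos) ((rdE (Nat.le_of_succ_le hj)).symm y)) with hz
  have hT : (tsV1 hc Λ' w).Qv ((tsV1 hc Λ' w).Gj (LinearMap.adjoint (tsV1 hc Λ' w).Qv z)) = y := by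
    rw [QGQ_apply hc hj Λ' hw, hz, LinearIsometryEquiv.symm_apply_apply]
    have h := LinearMap.congr_fun (comp_EE (Domains.whole (P := P) j (Nat.le_of_succ_le hj)) hc
      (w := fun _ => (1 : ℝ)) (fun _ => one_pos)) ((rdE (Nat.le_of_succ_le hj)).symm y)
    rw [LinearMap.comp_apply, LinearMap.id_apply, ← qgqE_def] at h
    rw [h, LinearIsometryEquiv.apply_symm_apply]
  rw [← hT]
  exact B6Eq2118DeltaJInverse.Ej_QGQ hL hP z

/-! ## §3  (2.130): `H_j` of the two-scale construction IS [BIJ85] (4.4.2) = [B5] (1.63)/(1.103) `H_j` — *"coincides with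
the operator introduced in Sect. D"* -/

/-- **(2.130) = (2.35) at the whole torus of order `j`**: `H_jB = GQ*(QGQ*)⁻¹(rdE⁻¹B)` with p21's `G`, `Q*`, `(QGQ*)⁻¹`.
[cite: Balaban1984PropagatorsII, (2.35) p.228 + (2.130) p.246] -/
theorem Hj_apply_V1 (y : UBond P j) :
    (tsV1 hc Λ' w).Hj y =
      B6SectA.hOp (GE (Domains.whole (P := P) j (Nat.le_of_succ_le hj)) hc (w := fun _ => (1 : ℝ)) (fun _ => one_pos))
        (QsE (Domains.whole (P := P) j (Nat.le_of_succ_le hj)))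
        (EE (Domains.whole (P := P) j (Nat.le_of_succ_le hj)) hc (w := fun _ => (1 : ℝ)) (fun _ => one_pos))
        ((rdE (Nat.le_of_succ_le hj)).symm y) := by
  rw [B6Eq2118DeltaJInverse.Hj_apply]
  show (tsV1 hc Λ' w).Gj (LinearMap.adjoint (Qv P j) ((tsV1 hc Λ' w).Ej y)) = _
  rw [Gj_eq_GE hc hj Λ' hw, adjoint_Qv_eq (Nat.le_of_succ_le hj), Ej_apply hc hj Λ' hw, LinearIsometryEquiv.symm_apply_apply]
  rfl

/-- **p. 246: *"H_j = G_jQ_j*(Q_jG_jQ_j*)⁻¹ (2.130) Thus this operator coincides with the operator introduced in Sect. D."* — for the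
CONCRETE two-scale operators: `H_jB = H_k(opsV1 P j c s) B`, the Landau-gauge minimizer (4.4.2) of [BIJ85] = (1.63)/(1.103) of [B5],
for every `B` on `T^{(j)}` and every norm weight `s ≠ 0`.** [cite: Balaban1984PropagatorsII, (2.130) p.246] -/
theorem Hj_eq_Hk (hs : s ≠ 0) (B : VecField P j ℝ) : (tsV1 hc Λ' w).Hj (WithLp.toLp 2 B) = Hk (opsV1 P j c s) B := by
  rw [Hj_apply_V1 hc hj Λ' hw, hOp_whole_rdE_symm (Nat.le_of_succ_le hj) hc hs (fun _ => one_pos) B]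

/-- … on `ℓ²` data: `H_jy = H_k(opsV1 P j c s)(y)`. [cite: Balaban1984PropagatorsII, (2.130) p.246] -/
theorem Hj_eq_Hk' (hs : s ≠ 0) (y : UBond P j) : (tsV1 hc Λ' w).Hj y = Hk (opsV1 P j c s) (WithLp.ofLp y) := by
  rw [← Hj_eq_Hk hc hj Λ' hw hs (WithLp.ofLp y), WithLp.toLp_ofLp]

/-- **… and carried to the tower it is the closed form (1.63) `hkT`** ([B5] p. 28 *"This defines the operator H_kB = A"*; p16's
`tVE_hOp_whole_rdE_symm`). [cite: Balaban1984PropagatorsI, (1.63) p.28] -/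
theorem tVE_Hj (B : VecField P j ℝ) :
    B5Eq147TorusBridge.tVE P (Nat.le_of_succ_le hj) ((tsV1 hc Λ' w).Hj (WithLp.toLp 2 B)) =
      B5HkOpLandauMin.hkT P.L (B5Eq117TorusCarriers.Mk P j) j (B5Eq117TorusCarriers.tB B) := by
  rw [Hj_apply_V1 hc hj Λ' hw, tVE_hOp_whole_rdE_symm (Nat.le_of_succ_le hj) hc one_ne_zero (fun _ => one_pos) B]

/-- **[B5] p. 29 *"R∂*H_kB = 0"* for the concrete `H_j` of (2.130)**, with `R` of the whole torus of order `j` (this seat's abstract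
`…B6Eq2118DeltaJInverse.Rj_dv_Hj` read on `tsV1`). [cite: Balaban1984PropagatorsI, p.29 (text) + (1.47) p.26] -/
theorem RE_dsE_Hj_eq_zero (y : UBond P j) :
    RE (Domains.whole (P := P) j (Nat.le_of_succ_le hj)) c (dsE c ((tsV1 hc Λ' w).Hj y)) = 0 := by
  rw [← Rj_eq_RE hc Λ' (Nat.le_of_succ_le hj)]
  exact B6Eq2118DeltaJInverse.Rj_dv_Hj (isLattice Λ' hc hj hw) (positive Λ' hc hj w) y

/-- … in p11's vocabulary: `R∂*(H_jy) = 0` for `R = projR`, `∂* = dstar` of `opsV1 P j c s`. [cite: Balaban1984PropagatorsI, (1.47) p.26] -/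
theorem projR_dstar_Hj_eq_zero (hs : s ≠ 0) (y : UBond P j) :
    (opsV1 P j c s).projR ((opsV1 P j c s).dstar ((tsV1 hc Λ' w).Hj y)) = 0 :=
  (RE_dsE_whole_eq_zero_iff (Nat.le_of_succ_le hj) c hs _).mp (RE_dsE_Hj_eq_zero hc hj Λ' hw y)

/-- … i.e. `H_jy` lies in the Landau space `{A : R∂*A = 0}` of [B5] (1.47) (p38's `…B5Eq164LandauV1.lan`). [cite: Balaban1984PropagatorsI, (1.47) p.26] -/
theorem Hj_mem_lan (hs : s ≠ 0) (y : UBond P j) : (tsV1 hc Λ' w).Hj y ∈ B5Eq164LandauV1.lan P j c s :=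
  (RE_dsE_whole_eq_zero_iff_mem_lan (Nat.le_of_succ_le hj) c hs _).mp (RE_dsE_Hj_eq_zero hc hj Λ' hw y)

/-! ## §4  (2.118): `⟨B, Δ_jB⟩ = ‖∂H_jB‖²` IS the [B5] (1.19)/(1.65) form `⟨B, Δ_kB⟩` -/

/-- **(2.116)–(2.118) for `tsV1`: `⟨B, Δ_jB⟩ = ‖∂H_jB‖²`** (`∂` = the plaquette curl `dcE c` of the fine torus).
[cite: Balaban1984PropagatorsII, (2.117)–(2.118) p.243] -/
theorem inner_Δj_V1 (y : UBond P j) : ⟪y, (tsV1 hc Λ' w).Δj y⟫_ℝ = ‖dcE c ((tsV1 hc Λ' w).Hj y)‖ ^ 2 :=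
  B6Eq2118DeltaJInverse.inner_Δj_eq_norm_curl_sq (isLattice Λ' hc hj hw) (positive Λ' hc hj w) y

/-- **(2.118) *"the quadratic forms are equal to ⟨B, Δ_jB⟩ given by (1.66)"* — CONCRETELY: the (2.118) form of `tsV1` IS the [B5]
(1.19)/(1.65) form, `⟨B, Δ_jB⟩ = B ⬝ (Δ_j^{[4]}B)` with `Δ_j^{[4]} = DeltaK P j 1 c`** (via (1.65) `⟨B, Δ_kB⟩ = ⟨∂H_kB, ∂H_kB⟩`, p16's
`inner_DeltaK_eq_norm_curl_Hk_sq`, and §3). [cite: Balaban1984PropagatorsII, (2.118) p.243] -/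
theorem inner_Δj_eq_DeltaK (B : VecField P j ℝ) :
    ⟪WithLp.toLp 2 B, (tsV1 hc Λ' w).Δj (WithLp.toLp 2 B)⟫_ℝ = B ⬝ᵥ (B5Eq119GaussianV1.DeltaK P j 1 c *ᵥ B) := by
  have h := B5Eq165GaugeMinimaV1.inner_DeltaK_eq_norm_curl_Hk_sq (Nat.le_of_succ_le hj) hc (one_ne_zero (α := ℝ)) B
  rw [one_pow, real_inner_self_eq_norm_sq, curl_opsV1_eq_smul_dcE, one_smul] at h
  rw [h, inner_Δj_V1 hc hj Λ' hw, Hj_eq_Hk hc hj Λ' hw one_ne_zero]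

/-- **`⟨B, (Q_jG_jQ_j*)⁻¹B⟩ = ‖B‖² + ⟨B, Δ_j^{[4]}B⟩`** for `tsV1` (this seat's `(Q_jG_jQ_j*)⁻¹ = I + Δ_j` read with §4).
[cite: Balaban1984PropagatorsII, (2.118) p.243 + (2.130) p.246] -/
theorem inner_Ej_eq_DeltaK (B : VecField P j ℝ) :
    ⟪WithLp.toLp 2 B, (tsV1 hc Λ' w).Ej (WithLp.toLp 2 B)⟫_ℝ =
      ‖WithLp.toLp 2 B‖ ^ 2 + B ⬝ᵥ (B5Eq119GaussianV1.DeltaK P j 1 c *ᵥ B) := by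
  rw [← inner_Δj_eq_DeltaK hc hj Λ' hw B,
    B6Eq2118DeltaJInverse.inner_Δj_eq (isLattice Λ' hc hj hw) (positive Λ' hc hj w)]
  ring

/-! ## §5  (v1.1) The kernel of the concrete `H_j` is the (1.63) torus kernel `HkOp` of [B5] -/

/-- **`(H_jB)(b₀) = Re((HkOp (L^j) (B5Eq117TorusCarriers.Mk P j) · B̃)(b̃₀))`** — the concrete two-scale `H_j` read through p38's `tVE`/`eBondK` and p21's
`pullR`/`towerE` IS r02-lineage's one-stroke torus operator `…B5Hk163Torus.HkOp` of (1.63) applied to `B̃ = cplx (tB B)`.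
[cite: Balaban1984PropagatorsI, (1.63) p.28] -/
theorem Hj_apply_eq_HkOp (B : VecField P j ℝ) (b₀ : PBond P 0) :
    (tsV1 hc Λ' w).Hj (WithLp.toLp 2 B) b₀ =
      ((B5Hk163Torus.HkOp (P.L ^ j) (B5Eq117TorusCarriers.Mk P j) *ᵥ B5SectBStatements.cplx (B5Eq117TorusCarriers.tB B))
        (B5TowerOneStroke.towerE P.L (B5Eq117TorusCarriers.Mk P j) j (B5Eq117TorusCarriers.eBondK (Nat.le_of_succ_le hj) b₀).1,
          (B5Eq117TorusCarriers.eBondK (Nat.le_of_succ_le hj) b₀).2)).re := by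
  have h := congrArg (fun F : B5SectBStatements.Fld (B5SectBStatements.towerM P.L (B5Eq117TorusCarriers.Mk P j) j) => F (B5Eq117TorusCarriers.eBondK (Nat.le_of_succ_le hj) b₀))
    (tVE_Hj hc hj Λ' hw B)
  simp only at h
  rw [B5Eq147TorusBridge.tVE_apply, Equiv.symm_apply_apply, B5HkOpLandauMin.hkT_def, B5TowerOneStroke.pullR_apply] at h
  exact h

/-- **the matrix entry `H_j(b₀, ·)` at the unit-lattice bond with torus label `i = (y, ν) ∈ Tor (B5Eq117TorusCarriers.Mk P j) × Fin d` is
`Re HkOp(b̃₀, i)`** (`Site P j` being `Tor (B5Eq117TorusCarriers.Mk P j)`, the bond is `⟨i.1, i.2⟩`, cf. p38's `tB_apply`).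
[cite: Balaban1984PropagatorsI, (1.63) p.28] -/
theorem Hj_single_apply [DecidableEq (PBond P j)] (i : B5Prop11Plancherel.Tor (B5Eq117TorusCarriers.Mk P j) × Fin P.d) (b₀ : PBond P 0) :
    (tsV1 hc Λ' w).Hj (WithLp.toLp 2 (Pi.single (⟨i.1, i.2⟩ : PBond P j) (1 : ℝ))) b₀ =
      (B5Hk163Torus.HkOp (P.L ^ j) (B5Eq117TorusCarriers.Mk P j)
        (B5TowerOneStroke.towerE P.L (B5Eq117TorusCarriers.Mk P j) j (B5Eq117TorusCarriers.eBondK (Nat.le_of_succ_le hj) b₀).1,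
          (B5Eq117TorusCarriers.eBondK (Nat.le_of_succ_le hj) b₀).2) i).re := by
  have hB : B5SectBStatements.cplx (B5Eq117TorusCarriers.tB (Pi.single (⟨i.1, i.2⟩ : PBond P j) (1 : ℝ) : VecField P j ℝ)) =
      Pi.single i (1 : ℂ) := by
    funext i'
    show (((Pi.single (⟨i.1, i.2⟩ : PBond P j) (1 : ℝ) : VecField P j ℝ) ⟨i'.1, i'.2⟩ : ℝ) : ℂ) =
      (Pi.single i (1 : ℂ) : B5Prop11Plancherel.Tor (B5Eq117TorusCarriers.Mk P j) × Fin P.d → ℂ) i'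
    by_cases h : i' = i
    · subst h
      rw [Pi.single_eq_same, Pi.single_eq_same, Complex.ofReal_one]
    · have h' : (⟨i'.1, i'.2⟩ : PBond P j) ≠ ⟨i.1, i.2⟩ := by
        intro e
        apply h
        injection e with e1 e2
        exact Prod.ext e1 e2
      rw [Pi.single_eq_of_ne h', Pi.single_eq_of_ne h, Complex.ofReal_zero]
  rw [Hj_apply_eq_HkOp hc hj Λ' hw, hB, Matrix.mulVec_single_one]
  rfl

/-- **the matrix entry `H_j(b₀, b) = Re HkOp(b̃₀, b̃)`**, `b̃ = (b.src, b.dir)`. [cite: Balaban1984PropagatorsI, (1.63) p.28] -/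
theorem Hj_single_apply' [DecidableEq (PBond P j)] (b : PBond P j) (b₀ : PBond P 0) :
    (tsV1 hc Λ' w).Hj (WithLp.toLp 2 (Pi.single b (1 : ℝ))) b₀ =
      (B5Hk163Torus.HkOp (P.L ^ j) (B5Eq117TorusCarriers.Mk P j)
        (B5TowerOneStroke.towerE P.L (B5Eq117TorusCarriers.Mk P j) j (B5Eq117TorusCarriers.eBondK (Nat.le_of_succ_le hj) b₀).1,
          (B5Eq117TorusCarriers.eBondK (Nat.le_of_succ_le hj) b₀).2)
        ((b.src, b.dir) : B5Prop11Plancherel.Tor (B5Eq117TorusCarriers.Mk P j) × Fin P.d)).re :=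
  Hj_single_apply hc hj Λ' hw ((b.src, b.dir) : B5Prop11Plancherel.Tor (B5Eq117TorusCarriers.Mk P j) × Fin P.d) b₀

/-- **hence p. 246 *"all the necessary properties of the operators H_j"* for the KERNEL of the concrete `H_j` are the torus bounds of
[B5] (1.63) BY NAME**: `|H_j(b₀, b)| ≤ ‖HkOp(b̃₀, b̃)‖` (then `…B5Hk163Torus.norm_HkOp_le`, row B5.Claim@28).
[cite: Balaban1984PropagatorsII, (2.130) p.246] -/
theorem abs_Hj_single_le_norm_HkOp [DecidableEq (PBond P j)] (b : PBond P j) (b₀ : PBond P 0) :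
    |(tsV1 hc Λ' w).Hj (WithLp.toLp 2 (Pi.single b (1 : ℝ))) b₀| ≤
      ‖B5Hk163Torus.HkOp (P.L ^ j) (B5Eq117TorusCarriers.Mk P j)
        (B5TowerOneStroke.towerE P.L (B5Eq117TorusCarriers.Mk P j) j (B5Eq117TorusCarriers.eBondK (Nat.le_of_succ_le hj) b₀).1,
          (B5Eq117TorusCarriers.eBondK (Nat.le_of_succ_le hj) b₀).2)
        ((b.src, b.dir) : B5Prop11Plancherel.Tor (B5Eq117TorusCarriers.Mk P j) × Fin P.d)‖ := by
  rw [Hj_single_apply' hc hj Λ' hw]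
  exact Complex.abs_re_le_norm _

end Literature.MathematicalPhysics.QuantumFieldTheory.Balaban1983to89.B6Eq2130TwoScaleV1Landau

end
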